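import Literature.Probability.RandomPlanarGeometry.HexSAWStripBridgeRenewal
import Literature.Probability.RandomPlanarGeometry.HexSAWStripThresholdLinearLower
import Literature.Probability.RandomPlanarGeometry.HexSAWStripThresholdHyperbolicLower
import Literature.Probability.RandomPlanarGeometry.HexSAWStripSeriesComparable
import HarnessLib

/-!
# The two-sided linear laws at the strip threshold, assembled: `B_{T,L}(x_c; y_T) ≍ L`, `Σ_{m ≤ M} β_{T,m} y_T^m ≍ M`,
# `Σ_{n ≤ N} x_cⁿ Z_{T,n}(y_T) ≍ N`, the first-order bound of the printed chain series `C_T(x_c; y)` below `y_T`, and the two-sided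
# first-order rate `B_T(x_c; y) ≍ 1/(y_T − y)`, `C_T(x_c; y) ≍ 1/(y_T − y)` as `y ↑ y_T`

Topic `Literature/Probability/RandomPlanarGeometry` (continues `HexSAWStripBridgeDecomposition.lean` / `HexSAWStripBridgeRenewal.lean` — the lane's first-order bound
(P) `HV.stripByLim_mul_sub_le_of_one_le`, the linear UPPER laws `HV.stripGFy_beta_stripYT_le_linear` (boxes) and
`HV.partialSum_stripBcoeff_stripYT_le_linear` (coefficients) — and `HexSAWStripThresholdLinearLower.lean` — the linear chain-to-bridge
comparison `HV.sum_pow_mul_stripZL_le_linear` and the LOWER laws `HV.exists_linear_le_stripGFy_beta_stripYT`,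
`HV.partialSum_stripBcoeff_stripYT_ge_linear`).  Source: N. R. Beaton, M. Bousquet-Mélou, J. de Gier, H. Duminil-Copin, A. J. Guttmann,
*The critical fugacity for surface adsorption of self-avoiding walks on the honeycomb lattice is `1 + √2`*, Comm. Math. Phys. 326 (2014)
727–754, arXiv:1109.0358v5, §3.2 Corollary 8 (p. 12): "There exists a unique `y_T > 0` such that `ρ_T(y_T) = x_c := 1/μ`. The series (in `y`)
`A_T(x_c, y)`, `B_T(x_c, y)` and `C_T(x_c, y)` have radius of convergence `y_T`" (proof, p. 13: "the series `C_T(x_c, y)` converges if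
`x_c < ρ_T(y)`, and diverges if `x_c > ρ_T(y)`"); proof of Proposition 7 (p. 12): "a rational function of `x` and `y`".  In print the three
series are rational, hence have POLES at `y_T`; neither the order of the pole nor a rate in the strip length is printed.

## What is proved (namespace `Literature.Probability.RandomPlanarGeometry.SAW.HV`; every constant depends on `T`)

* ★★★ `stripGFy_beta_stripYT_two_sided` (`T ≥ 1`): `∃ c C, 0 < c ∧ ∀ L, c (L+1) − C ≤ B_{T,L}(x_c; y_T) ≤ C (L+1)` — THE LINEAR DIVERGENCE LAW
  of the lane, both sides, every width; `stripGFy_beta_stripYT_eventually_two_sided` (`c L ≤ B_{T,L} ≤ C L` for large `L`).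
* ★★★ `partialSum_stripBcoeff_stripYT_two_sided` (`T ≥ 1`): `∃ s S, 0 < s ∧ ∀ M, s M − S ≤ Σ_{m ≤ M} β_{T,m} y_T^m ≤ S (M+1)` — the
  coefficient form (the lane's (R2), both sides, every width, unconditionally).
* ★★ `partialSum_pow_mul_stripZL_stripYT_two_sided` (`T ≥ 2`): `∃ k K, 0 < k ∧ ∀ N, k (N+1) ≤ Σ_{n ≤ N} x_cⁿ Z_{T,n}(y_T) ≤ K (N+1)` — the
  partial sums of the printed all-walks series `C_T(x_c; ·)` AT its radius grow linearly (lower half = the tree's Fekete floor).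
* ★★ `partialSum_pow_mul_stripZL_mul_sub_le` (`T ≥ 2`): `∃ A', ∀ y ∈ [1, y_T), ∀ N, (Σ_{n ≤ N} x_cⁿ Z_{T,n}(y)) · (y_T − y) ≤ A'` — the
  first-order bound of `C_T(x_c; ·)` at its radius (the printed divergence "if `x_c > ρ_T(y)`" is at most first order from the left).

* ★★★ `stripByLim_hyperbolic_two_sided` (`T ≥ 1`): `∃ a A C, 0 < a ∧ ∀ y ∈ [1, y_T), a/(y_T − y) − C ≤ B_T(x_c; y) ≤ A/(y_T − y)` — THE
  FIRST-ORDER RATE AT THE RADIUS, both sides (lower half: `HexSAWStripThresholdHyperbolicLower`; upper half: (P)); neighbourhood and filter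
  forms `stripByLim_mul_sub_two_sided`, `eventually_stripByLim_mul_sub_mem_Icc` (`B_T(x_c; y)(y_T − y) ∈ [a, A]` eventually as `y ↑ y_T`).
* ★★ `tsum_pow_mul_stripZL_hyperbolic_two_sided` (`T ≥ 2`): the same two-sided rate for the printed all-walks series
  `C_T(x_c; y) = Σ_n x_cⁿ Z_{T,n}(y)`, via `HexSAWStripSeriesComparable` (`x_c⁻¹ B_T ≤ C_T ≤ K₁ + K₂ B_T`).

Label: lane bookkeeping / ASSEMBLY of the parents (credit: the parents); the `C_T` statements are new corollaries of the same kind.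
Lane «pcv-sawmu», a-p2 g17/g18 (edition 3 adds the two-sided first-order rates).  NOT claimed: residues (existence of
`lim (y_T − y) B_T(x_c; y)`), `T`-uniformity, the chain laws at `T = 1` (the comparison is stated
for `T ≥ 2`; width one is explicit in the tree).
-/

noncomputable section

open Finset Filter Topology Literature.Probability.LatticeModels Literature.Probability.Percolation

namespace Literature.Probability.RandomPlanarGeometry.SAW.HV

variable {T : ℕ}

/-- ★★★ **`B_{T,L}(x_c; y_T) ≍ L`, every `T ≥ 1`**: `∃ c C, 0 < c ∧ ∀ L, c (L+1) − C ≤ B_{T,L}(x_c; y_T) ≤ C (L+1)`.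
[cite: BeatonBousquetMelouDeGierDuminilCopinGuttmann2014, Corollary 8 (arXiv v5 p. 12) and proof of Proposition 7 (p. 12); lane «pcv-sawmu»: the linear divergence law, two-sided] -/
theorem stripGFy_beta_stripYT_two_sided (hT : 1 ≤ T) :
    ∃ c C : ℝ, 0 < c ∧ ∀ L : ℕ, c * ((L : ℝ) + 1) - C ≤ stripGFy T L (IsBetaDart T) (stripYT T) ∧
      stripGFy T L (IsBetaDart T) (stripYT T) ≤ C * ((L : ℝ) + 1) := by
  obtain ⟨c, hc, C₁, h₁⟩ := exists_linear_le_stripGFy_beta_stripYT hT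
  obtain ⟨C₂, h₂⟩ := stripGFy_beta_stripYT_le_linear hT
  have hC₂ : 0 ≤ C₂ := by
    have h := h₂ 0
    have h0 : 0 ≤ stripGFy T 0 (IsBetaDart T) (stripYT T) := stripGFy_nonneg' T 0 _ (stripYT_pos hT).le
    simp only [Nat.cast_zero, zero_add, mul_one] at h
    linarith
  refine ⟨c, max C₁ C₂, hc, fun L => ⟨?_, ?_⟩⟩
  · have := h₁ L
    linarith [le_max_left C₁ C₂]
  · have := h₂ L
    have hL : (0 : ℝ) ≤ (L : ℝ) + 1 := by positivity
    nlinarith [le_max_right C₁ C₂]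

/-- The same for large `L` without the additive constant: `∃ c C, 0 < c ∧ ∀ᶠ L, c L ≤ B_{T,L}(x_c; y_T) ≤ C L` (`T ≥ 1`).
[cite: BeatonBousquetMelouDeGierDuminilCopinGuttmann2014, Corollary 8 (arXiv v5 p. 12); lane «pcv-sawmu»] -/
theorem stripGFy_beta_stripYT_eventually_two_sided (hT : 1 ≤ T) :
    ∃ c C : ℝ, 0 < c ∧ ∀ᶠ L : ℕ in atTop, c * (L : ℝ) ≤ stripGFy T L (IsBetaDart T) (stripYT T) ∧
      stripGFy T L (IsBetaDart T) (stripYT T) ≤ C * (L : ℝ) := by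
  obtain ⟨c, hc, hev⟩ := eventually_linear_le_stripGFy_beta_stripYT hT
  obtain ⟨c', C, -, h⟩ := stripGFy_beta_stripYT_two_sided hT
  have hC : 0 ≤ C := by
    have h0 := (h 0).2
    have : 0 ≤ stripGFy T 0 (IsBetaDart T) (stripYT T) := stripGFy_nonneg' T 0 _ (stripYT_pos hT).le
    simp only [Nat.cast_zero, zero_add, mul_one] at h0
    linarith
  refine ⟨c, 2 * C, hc, ?_⟩
  filter_upwards [hev, eventually_ge_atTop 1] with L hL hL1
  refine ⟨hL, ((h L).2).trans ?_⟩
  have : (1 : ℝ) ≤ L := by exact_mod_cast hL1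
  nlinarith

/-- ★★★ **`Σ_{m ≤ M} β_{T,m} y_T^m ≍ M`, every `T ≥ 1`, unconditionally**: `∃ s S, 0 < s ∧ ∀ M, s M − S ≤ Σ_{m ≤ M} β_{T,m} y_T^m ≤ S (M+1)`.
[cite: BeatonBousquetMelouDeGierDuminilCopinGuttmann2014, Corollary 8 (arXiv v5 p. 12); lane «pcv-sawmu»: the route's (R2) law, two-sided] -/
theorem partialSum_stripBcoeff_stripYT_two_sided (hT : 1 ≤ T) :
    ∃ s S : ℝ, 0 < s ∧ ∀ M : ℕ, s * (M : ℝ) - S ≤ ∑ m ∈ range (M + 1), stripBcoeff T m * stripYT T ^ m ∧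
      ∑ m ∈ range (M + 1), stripBcoeff T m * stripYT T ^ m ≤ S * ((M : ℝ) + 1) := by
  obtain ⟨s, hs, C₁, h₁⟩ := partialSum_stripBcoeff_stripYT_ge_linear hT
  obtain ⟨C₂, h₂⟩ := partialSum_stripBcoeff_stripYT_le_linear hT
  have hC₂ : 0 ≤ C₂ := by
    have h := h₂ 0
    have h0 : 0 ≤ ∑ m ∈ range (0 + 1), stripBcoeff T m * stripYT T ^ m :=
      sum_nonneg fun m _ => mul_nonneg (stripBcoeff_nonneg hT m) (pow_nonneg (stripYT_pos hT).le m)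
    simp only [Nat.cast_zero, zero_add, mul_one] at h
    linarith
  refine ⟨s, max C₁ C₂, hs, fun M => ⟨?_, ?_⟩⟩
  · have := h₁ M
    linarith [le_max_left C₁ C₂]
  · have := h₂ M
    have hM : (0 : ℝ) ≤ (M : ℝ) + 1 := by positivity
    nlinarith [le_max_right C₁ C₂]

/-- ★★ **The chain series at its radius: `Σ_{n ≤ N} x_cⁿ Z_{T,n}(y_T) ≍ N`** (`T ≥ 2`): the lower half is Fekete's floor
`(N+1)/max(1, y_T⁻¹)`, the upper half the linear comparison composed with the linear upper law of the boxes.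
[cite: BeatonBousquetMelouDeGierDuminilCopinGuttmann2014, Corollary 8 and its proof (arXiv v5 pp. 12–13: C_T(x_c, y) has radius y_T and diverges for x_c > ρ_T(y)); lane «pcv-sawmu»: NEW quantitative form AT the radius] -/
theorem partialSum_pow_mul_stripZL_stripYT_two_sided (hT : 2 ≤ T) :
    ∃ k K : ℝ, 0 < k ∧ ∀ N : ℕ, k * ((N : ℝ) + 1) ≤ ∑ n ∈ range (N + 1), hexCriticalFugacity ^ n * stripZL T n (stripYT T) ∧
      ∑ n ∈ range (N + 1), hexCriticalFugacity ^ n * stripZL T n (stripYT T) ≤ K * ((N : ℝ) + 1) := by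
  have hT1 : 1 ≤ T := by omega
  obtain ⟨K₁, K₂, hK₂, hK⟩ := sum_pow_mul_stripZL_le_linear hT
  obtain ⟨C, hC⟩ := stripGFy_beta_stripYT_le_linear hT1
  have hy := stripYT_pos hT1
  have hYK : 0 < HexBW.yK (stripYT T) := lt_of_lt_of_le one_pos (HexBW.one_le_yK _)
  refine ⟨(HexBW.yK (stripYT T))⁻¹, max K₁ 0 + K₂ * C, inv_pos.2 hYK, fun N => ⟨?_, ?_⟩⟩
  · have h := succ_le_mul_sum_pow_mul_stripZL hT1 hy (by rw [stripNu_stripYT hT1]) N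
    rw [inv_mul_le_iff₀ hYK]
    exact h
  · have h1 := hK (stripYT T) (one_le_stripYT hT1) le_rfl N
    have h2 := hC N
    have hN : (0 : ℝ) ≤ (N : ℝ) + 1 := by positivity
    have h3 : K₂ * stripGFy T N (IsBetaDart T) (stripYT T) ≤ K₂ * (C * ((N : ℝ) + 1)) := mul_le_mul_of_nonneg_left h2 hK₂.le
    have h4 : K₁ ≤ max K₁ 0 * ((N : ℝ) + 1) := by
      have : max K₁ 0 * 1 ≤ max K₁ 0 * ((N : ℝ) + 1) := mul_le_mul_of_nonneg_left (by linarith) (le_max_right _ _)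
      linarith [le_max_left K₁ 0]
    nlinarith

/-- ★★ **First-order bound of the chain series at its radius** (`T ≥ 2`): `∃ A', ∀ y ∈ [1, y_T), ∀ N,
(Σ_{n ≤ N} x_cⁿ Z_{T,n}(y)) · (y_T − y) ≤ A'` — the printed `C_T(x_c; y) = x_c Σ_n x_cⁿ Z_{T,n}(y)` diverges at most to first order as `y ↑ y_T`
(the linear comparison composed with the lane's (P) `HV.stripByLim_mul_sub_le_of_one_le`).
[cite: BeatonBousquetMelouDeGierDuminilCopinGuttmann2014, Corollary 8 and its proof (arXiv v5 pp. 12–13); lane «pcv-sawmu»: NEW (the order of the divergence of C_T from the left, without rationality)] -/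
theorem partialSum_pow_mul_stripZL_mul_sub_le (hT : 2 ≤ T) :
    ∃ A' : ℝ, ∀ y : ℝ, 1 ≤ y → y < stripYT T → ∀ N : ℕ,
      (∑ n ∈ range (N + 1), hexCriticalFugacity ^ n * stripZL T n y) * (stripYT T - y) ≤ A' := by
  have hT1 : 1 ≤ T := by omega
  obtain ⟨K₁, K₂, hK₂, hK⟩ := sum_pow_mul_stripZL_le_linear hT
  obtain ⟨A, hA⟩ := stripByLim_mul_sub_le_of_one_le hT1
  refine ⟨max K₁ 0 * stripYT T + K₂ * max A 0, fun y hy1 hyT N => ?_⟩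
  have hy0 : 0 ≤ y := by linarith
  have hw : 0 ≤ stripYT T - y := by linarith
  have hw' : stripYT T - y ≤ stripYT T := by linarith
  have h1 := hK y hy1 hyT.le N
  have hbdd := (bddAbove_stripGFy_beta_iff_lt_stripYT hT1 hy0).2 hyT
  have h2 : stripGFy T N (IsBetaDart T) y ≤ stripByLim T y := le_ciSup hbdd N
  have h3 := hA y hy1 hyT
  have hB0 : 0 ≤ stripGFy T N (IsBetaDart T) y := stripGFy_nonneg' T N _ hy0
  calc (∑ n ∈ range (N + 1), hexCriticalFugacity ^ n * stripZL T n y) * (stripYT T - y)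
      ≤ (K₁ + K₂ * stripGFy T N (IsBetaDart T) y) * (stripYT T - y) := mul_le_mul_of_nonneg_right h1 hw
    _ ≤ (max K₁ 0 + K₂ * stripByLim T y) * (stripYT T - y) := by
        refine mul_le_mul_of_nonneg_right ?_ hw
        linarith [le_max_left K₁ 0, mul_le_mul_of_nonneg_left h2 hK₂.le]
    _ = max K₁ 0 * (stripYT T - y) + K₂ * (stripByLim T y * (stripYT T - y)) := by ring
    _ ≤ max K₁ 0 * stripYT T + K₂ * max A 0 := by
        refine add_le_add (mul_le_mul_of_nonneg_left hw' (le_max_right _ _)) (mul_le_mul_of_nonneg_left ?_ hK₂.le)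
        exact h3.trans (le_max_left _ _)

/-! ### The first-order rate at the radius, both sides -/

/-- ★★★ **THE FIRST-ORDER RATE AT THE RADIUS, both sides, every `T ≥ 1`**: there are `a > 0`, `A`, `C` with
`a/(y_T − y) − C ≤ B_T(x_c; y) ≤ A/(y_T − y)` for every `y ∈ [1, y_T)` — `B_T(x_c; y) ≍ 1/(y_T − y)` as `y ↑ y_T`.  Lower half: the Abelian
step on the lower coefficient law (`exists_div_sub_le_stripByLim`); upper half: the lane's bound (P) (`stripByLim_mul_sub_le_of_one_le`).
[cite: BeatonBousquetMelouDeGierDuminilCopinGuttmann2014, Corollary 8 (arXiv v5 p. 12: radius y_T) and proof of Proposition 7 (p. 12: "a rational function of x and y"); lane «pcv-sawmu»: two-sided first-order bounds, automaton-free] -/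
theorem stripByLim_hyperbolic_two_sided (hT : 1 ≤ T) :
    ∃ a A C : ℝ, 0 < a ∧ ∀ y : ℝ, 1 ≤ y → y < stripYT T →
      a / (stripYT T - y) - C ≤ stripByLim T y ∧ stripByLim T y ≤ A / (stripYT T - y) := by
  obtain ⟨a, ha, C, hC⟩ := exists_div_sub_le_stripByLim hT
  obtain ⟨A, hA⟩ := stripByLim_mul_sub_le_of_one_le hT
  refine ⟨a, A, C, ha, fun y hy1 hyT => ⟨hC y (by linarith) hyT, ?_⟩⟩
  rw [le_div_iff₀ (sub_pos.2 hyT)]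
  exact hA y hy1 hyT

/-- ★★ `a ≤ B_T(x_c; y)·(y_T − y) ≤ A` on a whole left neighbourhood `[y₀, y_T)` of the radius (`T ≥ 1`, `0 < a`).
[cite: BeatonBousquetMelouDeGierDuminilCopinGuttmann2014, Corollary 8 (arXiv v5 p. 12); lane «pcv-sawmu»: two-sided first-order rate] -/
theorem stripByLim_mul_sub_two_sided (hT : 1 ≤ T) :
    ∃ a A : ℝ, 0 < a ∧ ∃ y₀ : ℝ, y₀ < stripYT T ∧ ∀ y ∈ Set.Ico y₀ (stripYT T),
      a ≤ stripByLim T y * (stripYT T - y) ∧ stripByLim T y * (stripYT T - y) ≤ A := by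
  obtain ⟨a, ha, y₀, hy₀, h⟩ := exists_Ico_le_stripByLim_mul_sub hT
  obtain ⟨A, hA⟩ := stripByLim_mul_sub_le_of_one_le hT
  refine ⟨a, A, ha, max y₀ 1, max_lt hy₀ (one_lt_stripYT hT), fun y hy => ⟨h y ⟨(le_max_left _ _).trans hy.1, hy.2⟩, ?_⟩⟩
  exact hA y ((le_max_right _ _).trans hy.1) hy.2

/-- ★★ Filter form: `∃ 0 < a ≤ A`, eventually as `y ↑ y_T`, `B_T(x_c; y)·(y_T − y) ∈ [a, A]` (`T ≥ 1`).
[cite: BeatonBousquetMelouDeGierDuminilCopinGuttmann2014, Corollary 8 (arXiv v5 p. 12); lane «pcv-sawmu»: two-sided first-order rate] -/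
theorem eventually_stripByLim_mul_sub_mem_Icc (hT : 1 ≤ T) :
    ∃ a A : ℝ, 0 < a ∧ ∀ᶠ y in 𝓝[<] stripYT T, stripByLim T y * (stripYT T - y) ∈ Set.Icc a A := by
  obtain ⟨a, A, ha, y₀, hy₀, h⟩ := stripByLim_mul_sub_two_sided hT
  exact ⟨a, A, ha, mem_of_superset (Ico_mem_nhdsLT hy₀) fun y hy => h y hy⟩

/-- ★★ **The printed all-walks series has the same two-sided first-order rate** (`T ≥ 2`): `a/(y_T − y) − C ≤ C_T(x_c; y) ≤ A/(y_T − y) + C`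
on `[1, y_T)`; from the bridge rate and `x_c⁻¹ B_T ≤ C_T ≤ K₁ + K₂ B_T` (`stripByLim_linear_equivalent_tsum`).
[cite: BeatonBousquetMelouDeGierDuminilCopinGuttmann2014, Corollary 8 and its proof (arXiv v5 pp. 12–13); lane «pcv-sawmu»: two-sided first-order rate of C_T] -/
theorem tsum_pow_mul_stripZL_hyperbolic_two_sided (hT : 2 ≤ T) :
    ∃ a A C : ℝ, 0 < a ∧ ∀ y : ℝ, 1 ≤ y → y < stripYT T →
      a / (stripYT T - y) - C ≤ ∑' n, hexCriticalFugacity ^ n * stripZL T n y ∧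
        ∑' n, hexCriticalFugacity ^ n * stripZL T n y ≤ A / (stripYT T - y) + C := by
  have hT1 : 1 ≤ T := by omega
  have hx := hexCriticalFugacity_pos_lt_one
  obtain ⟨a, A, C, ha, hB⟩ := stripByLim_hyperbolic_two_sided hT1
  obtain ⟨K₁, K₂, hK₂, hK⟩ := stripByLim_linear_equivalent_tsum hT
  have hxi : 1 ≤ hexCriticalFugacity⁻¹ := (one_le_inv₀ hx.1).2 hx.2.le
  refine ⟨a, K₂ * max A 0, max (hexCriticalFugacity⁻¹ * max C 0) (max K₁ 0), ha, fun y hy1 hyT => ?_⟩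
  obtain ⟨hlo, hhi⟩ := hB y hy1 hyT
  obtain ⟨hclo, hchi⟩ := hK y hy1 hyT
  have hd : 0 < stripYT T - y := sub_pos.2 hyT
  constructor
  · have had : 0 ≤ a / (stripYT T - y) := div_nonneg ha.le hd.le
    have h0 : a / (stripYT T - y) - max C 0 ≤ stripByLim T y := by linarith [le_max_left C 0]
    have h1 : a / (stripYT T - y) - hexCriticalFugacity⁻¹ * max C 0 ≤ hexCriticalFugacity⁻¹ * stripByLim T y := by
      nlinarith [le_max_right C 0]
    calc a / (stripYT T - y) - max (hexCriticalFugacity⁻¹ * max C 0) (max K₁ 0)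
        ≤ a / (stripYT T - y) - hexCriticalFugacity⁻¹ * max C 0 := by
          linarith [le_max_left (hexCriticalFugacity⁻¹ * max C 0) (max K₁ 0)]
      _ ≤ _ := h1.trans hclo
  · calc ∑' n, hexCriticalFugacity ^ n * stripZL T n y ≤ K₁ + K₂ * stripByLim T y := hchi
      _ ≤ max K₁ 0 + K₂ * (max A 0 / (stripYT T - y)) := by
          refine add_le_add (le_max_left _ _) (mul_le_mul_of_nonneg_left ?_ hK₂.le)
          exact hhi.trans (div_le_div_of_nonneg_right (le_max_left _ _) hd.le)
      _ ≤ K₂ * max A 0 / (stripYT T - y) + max (hexCriticalFugacity⁻¹ * max C 0) (max K₁ 0) := by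
          rw [mul_div_assoc]; linarith [le_max_right (hexCriticalFugacity⁻¹ * max C 0) (max K₁ 0)]

end Literature.Probability.RandomPlanarGeometry.SAW.HV
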